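import Summits.QuantumFields.YangMills.Theorems.SmallCircleAnchorAnchorGapGramHadamardPosDef
import Summits.QuantumFields.YangMills.Theorems.SmallCircleAnchorAnchorGapGaussianCovSmooth
import Literature.Probability.LatticeModels.BattleFederbushGram
import Literature.MeasureTheory.Integral.PolynomialCubeIntegral
import HarnessLib

/-!
# Crux `AnchorGap` (stmt-QuantumFields-11141), line `registered` — the pair-interpolated covariance of
# GREP is positive definite at every FULL interpolation point (step (G1c) of the assembly of GREP)

For GREP (`stub_gaussianBBFPolymerRep`) the peeling formula (✓PEEL) is applied to
`σ ↦ E(cov X σ)(Π G)` with `cov X σ = ((blk i = blk j ? 1 : blk i, blk j ∈ X ? σ{blk i, blk j} : 0)·C_ij)`;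
its smoothness hypothesis needs `cov X σ` positive definite on a neighbourhood of every FULL point
`ρ_s(t)` of every valid script `s` (`t ∈ [0,1]^β`).  With ✓`GaussSmooth.isOpen_posDef_preimage` and
✓`GaussSmooth.contDiffOn_gaussExpect_cov` (p790537) it suffices to know positive definiteness AT the
full points, which is proved here: the full-point factors are inner products of UNIT vectors — the
tree's Gram vectors `BattleFederbush.gramVec` at the levels of the atoms (`0,…,k` for the points of the
script, `k+1` for every other atom of `X`), and fresh orthonormal directions for the atoms off `X` — so
✓GRAM (`stub_gramHadamardPosDef`) applies.  [folklore]; no definition, no named fact.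

* `mem_pre_iff_of_level`, `cutExp_succ_eq_sum_of_levels`, `eval_fullPt_of_levels` — the value of the
  full interpolation point on a pair of atoms of levels `n_a ≤ n_b ≤ k+1`:
  `ρ_s(t){a,b} = ∏_{l ∈ [n_a, n_b)} t(y_l)` (the `decPt_mk_y` computation with the last cut included);
* `exists_level` — every atom has a level;
* `posDef_cov_fullPt` — the statement above (any root, any length, any `X`);
* `exists_open_smooth_domain` — **PEEL's smoothness hypothesis for GREP**: an open set of pair
  parameters containing every full point on which `σ ↦ E(cov X σ)(H)` is `C^∞`, for every measurable
  `H` of polynomial growth (✓`GaussSmooth.isOpen_posDef_preimage`, ✓`contDiffOn_gaussExpect_cov`).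
-/

set_option autoImplicit false

namespace Summit.QuantumFields.YangMills.Theorems.AnchorGap.FullPt

open Finset MvPolynomial Literature.Probability.LatticeModels
  Literature.Probability.LatticeModels.BattleFederbush Literature.MeasureTheory.Integral
open scoped InnerProductSpace Matrix

variable {β : Type} [DecidableEq β] {r : β} {k : ℕ}

/-- Membership in the prefix sets by LEVEL: an atom of level `n` (the index of the script point it
is, or `k+1` if it is not a point of the script) lies in `X_{m+1}` iff `n ≤ m` (`m ≤ k`). [folklore] -/
theorem mem_pre_iff_of_level (s : Script r k) (hs : s.Valid) {a : β} {n : ℕ}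
    (h : (∃ i : Fin (k + 1), s.y i = a ∧ (i : ℕ) = n) ∨ (a ∉ univ.image s.y ∧ n = k + 1))
    {m : ℕ} (hm : m ≤ k) : a ∈ s.pre m ↔ n ≤ m := by
  rcases h with ⟨i, rfl, rfl⟩ | ⟨ha, rfl⟩
  · exact Script.y_mem_pre_iff s hs i m
  · constructor
    · intro hmem
      obtain ⟨m', -, hm'⟩ := (Script.mem_pre s m a).1 hmem
      exact absurd (mem_image.2 ⟨m', mem_univ _, hm'⟩) ha
    · intro h; omega

/-- The exponent vector of the FULL interpolation point on a pair of atoms of levels `n_a ≤ n_b`: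
`Σ_{n_a ≤ m < n_b} e_{y_m}`. [folklore] -/
theorem cutExp_succ_eq_sum_of_levels (s : Script r k) (hs : s.Valid) {a b : β} {na nb : ℕ}
    (ha : (∃ i : Fin (k + 1), s.y i = a ∧ (i : ℕ) = na) ∨ (a ∉ univ.image s.y ∧ na = k + 1))
    (hb : (∃ i : Fin (k + 1), s.y i = b ∧ (i : ℕ) = nb) ∨ (b ∉ univ.image s.y ∧ nb = k + 1))
    (hab : na ≤ nb) :
    s.cutExp (k + 1) s(a, b)
      = ∑ m ∈ univ.filter (fun m : Fin (k + 1) => na ≤ (m : ℕ) ∧ (m : ℕ) < nb), Finsupp.single (s.y m) 1 := by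
  rw [Script.cutExp, Finset.sum_filter]
  refine Finset.sum_congr rfl fun m _ => ?_
  have hmk : (m : ℕ) ≤ k := Nat.lt_succ_iff.1 m.isLt
  have hcross : (crossB (s.pre m) s(a, b) = true) ↔ (na ≤ (m : ℕ) ∧ (m : ℕ) < nb) := by
    rw [crossB_mk]
    have h1 := mem_pre_iff_of_level s hs ha hmk
    have h2 := mem_pre_iff_of_level s hs hb hmk
    by_cases hna : na ≤ (m : ℕ) <;> by_cases hnb : nb ≤ (m : ℕ)
    · simp [h1.2 hna, h2.2 hnb]; omega
    · simp [h1.2 hna, show b ∉ s.pre m from fun h => hnb (h2.1 h)]; omega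
    · exfalso; omega
    · simp [show a ∉ s.pre m from fun h => hna (h1.1 h), show b ∉ s.pre m from fun h => hnb (h2.1 h)]
      omega
  by_cases hc : na ≤ (m : ℕ) ∧ (m : ℕ) < nb
  · rw [if_pos ⟨m.isLt, hcross.2 hc⟩, if_pos hc]
  · rw [if_neg (fun h => hc (hcross.1 h.2)), if_neg hc]

/-- **The value of the full interpolation point on a pair of atoms of levels `n_a ≤ n_b ≤ k+1`:**
`ρ_s(t){a,b} = ∏_{l ∈ [n_a, n_b)} t(y_l)`. [folklore] -/
theorem eval_fullPt_of_levels (s : Script r k) (hs : s.Valid) (t : β → ℝ) {a b : β} {na nb : ℕ}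
    (ha : (∃ i : Fin (k + 1), s.y i = a ∧ (i : ℕ) = na) ∨ (a ∉ univ.image s.y ∧ na = k + 1))
    (hb : (∃ i : Fin (k + 1), s.y i = b ∧ (i : ℕ) = nb) ∨ (b ∉ univ.image s.y ∧ nb = k + 1))
    (hab : na ≤ nb) (hnb : nb ≤ k + 1) :
    eval t (Script.fullPt ℝ s s(a, b))
      = ∏ l ∈ Ico na nb, (if h : l < k + 1 then t (s.y ⟨l, h⟩) else 0) := by
  rw [Script.fullPt, cutExp_succ_eq_sum_of_levels s hs ha hb hab]
  -- the monomial of a sum of distinct unit exponents is the product of the variables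
  have hmon : ∀ S : Finset (Fin (k + 1)),
      (monomial (∑ m ∈ S, Finsupp.single (s.y m) 1) (1 : ℝ) : MvPolynomial β ℝ) = ∏ m ∈ S, X (s.y m) := by
    intro S
    induction S using Finset.induction_on with
    | empty => simp
    | insert a S ha' ih => rw [Finset.sum_insert ha', Finset.prod_insert ha', monomial_single_add, pow_one, ih]
  rw [hmon, map_prod]
  simp only [eval_X]
  -- reindex `Fin (k+1)` ↦ `ℕ`
  refine Finset.prod_bij (fun m _ => (m : ℕ)) ?_ ?_ ?_ ?_
  · intro m hm
    obtain ⟨h1, h2⟩ := (mem_filter.1 hm).2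
    exact mem_Ico.2 ⟨h1, h2⟩
  · intro m _ m' _ h; exact Fin.ext h
  · intro l hl
    obtain ⟨h1, h2⟩ := mem_Ico.1 hl
    exact ⟨⟨l, by omega⟩, mem_filter.2 ⟨mem_univ _, h1, h2⟩, rfl⟩
  · intro m hm
    rw [dif_pos m.isLt]

/-- Every atom has a level `≤ k+1`. [folklore] -/
theorem exists_level (s : Script r k) (a : β) :
    ∃ n : ℕ, n ≤ k + 1 ∧ ((∃ i : Fin (k + 1), s.y i = a ∧ (i : ℕ) = n) ∨ (a ∉ univ.image s.y ∧ n = k + 1)) := by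
  by_cases ha : a ∈ univ.image s.y
  · obtain ⟨i, -, hi⟩ := mem_image.1 ha
    exact ⟨i, by have := i.isLt; omega, Or.inl ⟨i, hi, rfl⟩⟩
  · exact ⟨k + 1, le_rfl, Or.inr ⟨ha, rfl⟩⟩

/-- **The pair-interpolated covariance of GREP is positive definite at every full interpolation
point.** For `C` positive definite, atoms `blk : ι → β`, any atom set `X`, any valid script `s` (any
root, any length) and `t ∈ [0,1]^β`, the matrix
`((blk i = blk j ? 1 : blk i, blk j ∈ X ? ρ_s(t){blk i, blk j} : 0) · C_ij)` is positive definite: its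
factors are `⟪u_{blk i}, u_{blk j}⟫` for the unit vectors `u_a = gramVec (level a)` (`a ∈ X`),
`u_a =` a fresh basis vector (`a ∉ X`) — `inner_gramVec` + `eval_fullPt_of_levels`,
`inner_gramVec_stdVec_eq_zero`, `inner_stdVec_stdVec` — and ✓GRAM `stub_gramHadamardPosDef` applies.
[folklore] -/
theorem posDef_cov_fullPt (ι : Type) [Fintype ι] [DecidableEq ι] [Fintype β] (blk : ι → β)
    (C : Matrix ι ι ℝ) (hC : C.PosDef) (X : Finset β) (s : Script r k) (hs : s.Valid)
    (t : β → ℝ) (ht : ∀ a, t a ∈ Set.Icc (0 : ℝ) 1) :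
    (Matrix.of fun i j : ι => (if blk i = blk j then 1 else if blk i ∈ X ∧ blk j ∈ X
      then eval t (Script.fullPt ℝ s s(blk i, blk j)) else 0) * C i j).PosDef := by
  classical
  -- levels
  have hlev := exists_level s
  choose lv hlvk hlv using hlev
  -- parameters of the Gram vectors
  set τ : ℕ → ℝ := fun l => if h : l < k + 1 then t (s.y ⟨l, h⟩) else 0 with hτdef
  have hτ : ∀ n, τ n ^ 2 ≤ 1 := by
    intro n
    simp only [hτdef]
    split_ifs with h
    · obtain ⟨h0, h1⟩ := ht (s.y ⟨n, h⟩)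
      nlinarith
    · norm_num
  -- the vectors
  set N : ℕ := k + 2 + Fintype.card β with hN
  set e := Fintype.equivFin β with he
  set u : β → EuclideanSpace ℝ (Fin N) := fun a =>
    if a ∈ X then gramVec N τ (lv a) else stdVec N (k + 2 + e a) with hudef
  have hlvN : ∀ a, lv a < N := fun a => by have := hlvk a; omega
  have heN : ∀ a, k + 2 + (e a : ℕ) < N := fun a => by have := (e a).isLt; omega
  have hu : ∀ a, ‖u a‖ = 1 := by
    intro a
    simp only [hudef]
    split_ifs with ha
    · exact norm_gramVec τ hτ (hlvN a)
    · exact norm_stdVec (heN a)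
  -- the factors are the inner products
  have hinX : ∀ a b, a ∈ X → b ∈ X → lv a ≤ lv b →
      ⟪u a, u b⟫_ℝ = eval t (Script.fullPt ℝ s s(a, b)) := by
    intro a b ha hb hab
    simp only [hudef, if_pos ha, if_pos hb]
    rw [inner_gramVec τ hτ hab (hlvN b), eval_fullPt_of_levels s hs t (hlv a) (hlv b) hab (hlvk b)]
  have hfac : ∀ a b, ⟪u a, u b⟫_ℝ = (if a = b then 1 else if a ∈ X ∧ b ∈ X
      then eval t (Script.fullPt ℝ s s(a, b)) else 0) := by
    intro a b
    by_cases hab : a = b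
    · subst hab
      rw [if_pos rfl, real_inner_self_eq_norm_sq, hu, one_pow]
    rw [if_neg hab]
    by_cases hX : a ∈ X ∧ b ∈ X
    · rw [if_pos hX]
      rcases le_total (lv a) (lv b) with h | h
      · exact hinX a b hX.1 hX.2 h
      · rw [real_inner_comm, Sym2.eq_swap]; exact hinX b a hX.2 hX.1 h
    · rw [if_neg hX]
      by_cases ha : a ∈ X
      · have hb : b ∉ X := fun hb => hX ⟨ha, hb⟩
        simp only [hudef, if_pos ha, if_neg hb]
        exact inner_gramVec_stdVec_eq_zero τ (by have := hlvk a; omega)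
      · by_cases hb : b ∈ X
        · simp only [hudef, if_neg ha, if_pos hb]
          rw [real_inner_comm]
          exact inner_gramVec_stdVec_eq_zero τ (by have := hlvk b; omega)
        · simp only [hudef, if_neg ha, if_neg hb]
          rw [inner_stdVec_stdVec, if_neg]
          rintro ⟨h, -⟩
          exact hab (e.injective (Fin.ext (by omega)))
  have hM : (Matrix.of fun i j : ι => (if blk i = blk j then 1 else if blk i ∈ X ∧ blk j ∈ X
        then eval t (Script.fullPt ℝ s s(blk i, blk j)) else 0) * C i j)
      = Matrix.of fun i j : ι => ⟪u (blk i), u (blk j)⟫_ℝ * C i j := by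
    ext i j
    simp only [Matrix.of_apply]
    rw [hfac]
  rw [hM]
  exact stub_gramHadamardPosDef ι β blk C hC N u hu

/-- The same for parameters in the unit cube (the form of PEEL's hypothesis). [folklore] -/
theorem posDef_cov_fullPt_of_mem_unitCube (ι : Type) [Fintype ι] [DecidableEq ι] [Fintype β]
    (blk : ι → β) (C : Matrix ι ι ℝ) (hC : C.PosDef) (X : Finset β) (s : Script r k) (hs : s.Valid)
    {t : β → ℝ} (ht : t ∈ unitCube β) :
    (Matrix.of fun i j : ι => (if blk i = blk j then 1 else if blk i ∈ X ∧ blk j ∈ X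
      then eval t (Script.fullPt ℝ s s(blk i, blk j)) else 0) * C i j).PosDef :=
  posDef_cov_fullPt ι blk C hC X s hs t (mem_unitCube.1 ht)

/-! ### PEEL's smoothness hypothesis for GREP -/

/-- **An open smooth domain for the peeled expectation.** For `C` positive definite, atoms `blk`, an
atom set `X`, a root `r` and a measurable `H` of polynomial growth, the set
`U = {σ | cov X σ positive definite}` of pair parameters is OPEN, contains the full interpolation
point `ρ_s(t)` of every valid script `s` rooted at `r` and every `t ∈ [0,1]^β`, and the normalised
Gaussian expectation `σ ↦ E(cov X σ)(H) = ∫ H e^{−½φᵀ(cov X σ)⁻¹φ} ∕ ∫ e^{−½φᵀ(cov X σ)⁻¹φ}` is `C^∞`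
on `U` — the hypothesis of the peeling formula `stub_bbfPeelingAnalytic` for GREP's `f`, modulo the
closure of the smooth poly-growth class under the line operators (LOCATE-GREP (G2)). [folklore] -/
theorem exists_open_smooth_domain (ι : Type) [Fintype ι] [DecidableEq ι] [Fintype β] (blk : ι → β)
    (C : Matrix ι ι ℝ) (hC : C.PosDef) (X : Finset β) (r : β) (H : (ι → ℝ) → ℝ) (K : ℝ) (m : ℕ)
    (hHm : Measurable H) (hHb : ∀ φ : ι → ℝ, |H φ| ≤ K * (1 + ∑ i, φ i ^ 2) ^ m) :
    ∃ U : Set (Sym2 β → ℝ), IsOpen U ∧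
      (∀ (k : ℕ) (s : Script r k), s.Valid → ∀ t ∈ unitCube β,
        (fun ℓ : Sym2 β => eval t (Script.fullPt ℝ s ℓ)) ∈ U) ∧
      ContDiffOn ℝ (⊤ : ℕ∞) (fun σ : Sym2 β → ℝ =>
        (∫ φ : ι → ℝ, H φ * Real.exp (-(φ ⬝ᵥ ((Matrix.of fun i j : ι =>
            (if blk i = blk j then 1 else if blk i ∈ X ∧ blk j ∈ X then σ s(blk i, blk j) else 0)
              * C i j)⁻¹ *ᵥ φ)) / 2))
        / ∫ φ : ι → ℝ, Real.exp (-(φ ⬝ᵥ ((Matrix.of fun i j : ι =>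
            (if blk i = blk j then 1 else if blk i ∈ X ∧ blk j ∈ X then σ s(blk i, blk j) else 0)
              * C i j)⁻¹ *ᵥ φ)) / 2)) U := by
  -- the covariance family as a function into `ι → ι → ℝ`
  set cv : (Sym2 β → ℝ) → (ι → ι → ℝ) := fun σ i j =>
    (if blk i = blk j then 1 else if blk i ∈ X ∧ blk j ∈ X then σ s(blk i, blk j) else 0) * C i j
    with hcv
  have hcd : ContDiff ℝ (⊤ : ℕ∞) cv := by
    refine contDiff_pi.2 fun i => contDiff_pi.2 fun j => ?_
    by_cases h1 : blk i = blk j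
    · simp only [hcv, if_pos h1]; exact contDiff_const
    · by_cases h2 : blk i ∈ X ∧ blk j ∈ X
      · simp only [hcv, if_neg h1, if_pos h2]
        exact (contDiff_apply ℝ ℝ (s(blk i, blk j))).mul contDiff_const
      · simp only [hcv, if_neg h1, if_neg h2]; exact contDiff_const
  have hsymm : ∀ σ, (Matrix.of (cv σ)).IsSymm := by
    intro σ
    have hCs : ∀ i j, C j i = C i j := fun i j => by
      simpa using (hC.isHermitian.apply j i).symm
    ext i j
    simp only [Matrix.transpose_apply, Matrix.of_apply, hcv]
    rw [hCs i j, Sym2.eq_swap]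
    by_cases h1 : blk i = blk j
    · rw [if_pos h1, if_pos h1.symm]
    · rw [if_neg h1, if_neg (Ne.symm h1)]
      simp only [and_comm]
  refine ⟨{σ | (Matrix.of (cv σ)).PosDef}, GaussSmooth.isOpen_posDef_preimage hcd.continuous hsymm,
    fun k s hs t ht => ?_, ?_⟩
  · exact posDef_cov_fullPt_of_mem_unitCube ι blk C hC X s hs ht
  · exact (GaussSmooth.contDiffOn_gaussExpect_cov H K m hHm hHb).comp hcd.contDiffOn fun σ hσ => hσ

end Summit.QuantumFields.YangMills.Theorems.AnchorGap.FullPt
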